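import Literature.AlgebraicGeometry.HodgeTheory.HypersurfaceFamilyTopFormFrames
import Literature.AlgebraicGeometry.HodgeTheory.HodgeFrameOfRelativeFormsChart
import HarnessLib

/-!
# Holomorphic frames of `FⁿHⁿ` for the specialised hypersurface families, IN THE ALGEBRAIC CHART

Family `hodge`, layer `Literature/AlgebraicGeometry/HodgeTheory`. Theorems only; no definition, no named
fact. Written by the prover seat `hodge-nonav-prover-Ax` (g13, cell `hodge-nonav`), programme «AE»
(route `HodgeConjecture/CyclicUnitaryPowers`, `--supports stmt-HodgeConjecture-19544`).

`HypersurfaceFamilyTopFormFrames.exists_topFormFrame_familySpz` (brick FF4 of programme B4) gives, for the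
family of smooth hypersurfaces `f = familySpz ℂ (n₀+1) d sp : 𝒴_sp ⟶ S_sp`, Griffiths' holomorphic frames
of `FⁿHⁿ` in flat coordinates near every point `t₁` of the base — holomorphic on `ψ(W₀)` for SOME chart
`ψ`. This file records WHICH chart: the algebraic chart `ComplexPoints.algebraicChart S_sp m t₁` (Serre,
GAGA §2: regular coordinates; regular functions holomorphic in it), transferred to the `univ`-subtype
(`exists_weightFrames_of_relativeForms_chartAt`).

* `exists_topFormFrame_familySpz_chartAt` — the conclusion of `exists_topFormFrame_familySpz` plus the
  three identities `ψ t = algebraicChart S_sp m t₁ t`, `t ∈ ψ.source ↔ t ∈ (algebraicChart S_sp m t₁).source`,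
  `ψ.symm z = (algebraicChart S_sp m t₁).symm z`. This is the hypothesis `hF2` of
  `hodgeLociAlternative_of_weightTwoFrames` ∕ `exists_countable_analyticCover_…_of_weightTwoFrames` with
  `Good ψ` := «`ψ` is the algebraic chart at some point», the form in which the exceptional Hodge loci can
  be compared with the (regular, hence holomorphic) coefficient functions of the base.

HONEST FRAMING: nothing here says HC is proved; the crux item 19544 as typed still needs CDK.

## References

* [Griffiths1968PeriodsII] P. Griffiths, Periods of integrals on algebraic manifolds II, Amer. J. Math. 90
  (1968), Thm. 1.1.
* [VoisinHodgeII2003] C. Voisin, Hodge Theory and Complex Algebraic Geometry II (2003), §6.1.3, §6.2.1.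
* [SerreGAGA1956] J.-P. Serre, Géométrie algébrique et géométrie analytique, §2 n°5.
-/

noncomputable section

open scoped Manifold ContDiff Topology TensorProduct
open CategoryTheory AlgebraicGeometry Set Filter Complex
open _root_.Topology
open Literature.NumberTheory.Transcendental Literature.Geometry.Kaehler Literature.AlgebraicGeometry.Motives
open Literature.AlgebraicGeometry.Motives.UniversalHypersurface
open Literature.AlgebraicGeometry.HodgeTheory.UniversalHypersurface
open Literature.AlgebraicTopology.SingularHomology

namespace Literature.AlgebraicGeometry.HodgeTheory

set_option backward.isDefEq.respectTransparency false

section FF4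

variable (n₀ d : ℕ) {σ : Type} [Finite σ] (sp : CoeffRing ℂ (n₀ + 1) d →ₐ[ℂ] MvPolynomial σ ℂ)

/-- **Holomorphic frames of `FⁿHⁿ` in flat coordinates for the family of smooth hypersurfaces
`𝒴_sp ⟶ S_sp`, read in the ALGEBRAIC CHART at `t₁`**: the statement of `exists_topFormFrame_familySpz`
(Griffiths' holomorphy of `Fⁿ ⊂ Hⁿ ⊗ 𝒪` for these families, by periods of relative residue forms) with
the chart `ψ` identified — `ψ` is `ComplexPoints.algebraicChart S_sp m t₁` on values, source and inverse.
[cite: Griffiths1968PeriodsII, Thm. 1.1] [cite: VoisinHodgeII2003, §6.1.3 and §6.2.1]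
[cite: SerreGAGA1956, §2 n°5 Prop. 2] -/
theorem exists_topFormFrame_familySpz_chartAt (hd : n₀ + 1 + 2 ≤ d) (m : ℕ)
    [AlgebraicGeometry.SmoothOfRelativeDimension m (baseSpz ℂ (n₀ + 1) d sp).hom]
    [AlgebraicGeometry.LocallyOfFiniteType (baseSpz ℂ (n₀ + 1) d sp).hom]
    (hf : IsSmoothProjectiveFamily (familySpz ℂ (n₀ + 1) d sp) (n₀ + 1))
    (hU : IsCohomologicallyLocallyTrivialOn (familySpz ℂ (n₀ + 1) d sp)
      (Set.univ : Set (ComplexPoints (baseSpz ℂ (n₀ + 1) d sp))))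
    (A : ∀ t : ComplexPoints (baseSpz ℂ (n₀ + 1) d sp),
      HodgeModel (n₀ + 1) (fiberOver (familySpz ℂ (n₀ + 1) d sp) t))
    (hA : ∀ t, (A t).IsHodgeSymmetric)
    (s t₁ : (Set.univ : Set (ComplexPoints (baseSpz ℂ (n₀ + 1) d sp))))
    (N : Set (Set.univ : Set (ComplexPoints (baseSpz ℂ (n₀ + 1) d sp)))) (hN : N ∈ 𝓝 t₁)
    (T₁ : singularCohomology ℚ ℚ (ComplexPoints (fiberOver (familySpz ℂ (n₀ + 1) d sp) s.1)) (n₀ + 1) ≃ₗ[ℚ]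
      singularCohomology ℚ ℚ (ComplexPoints (fiberOver (familySpz ℂ (n₀ + 1) d sp) t₁.1)) (n₀ + 1)) :
    ∃ W₀ : Set (Set.univ : Set (ComplexPoints (baseSpz ℂ (n₀ + 1) d sp))), IsOpen W₀ ∧ t₁ ∈ W₀ ∧ W₀ ⊆ N ∧
      IsPathConnected W₀ ∧
    ∃ ψ : OpenPartialHomeomorph (Set.univ : Set (ComplexPoints (baseSpz ℂ (n₀ + 1) d sp))) (Fin m → ℂ),
      ((∀ t, (ψ t : Fin m → ℂ) = ComplexPoints.algebraicChart (baseSpz ℂ (n₀ + 1) d sp) m t₁.1 t.1) ∧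
        (∀ t, t ∈ ψ.source ↔
          t.1 ∈ (ComplexPoints.algebraicChart (baseSpz ℂ (n₀ + 1) d sp) m t₁.1).source) ∧
        (∀ z, ((ψ.symm z : (Set.univ : Set (ComplexPoints (baseSpz ℂ (n₀ + 1) d sp)))) :
            ComplexPoints (baseSpz ℂ (n₀ + 1) d sp)) =
          (ComplexPoints.algebraicChart (baseSpz ℂ (n₀ + 1) d sp) m t₁.1).symm z)) ∧
      W₀ ⊆ ψ.source ∧
    ∃ (r₂ : ℕ) (w₂ : Fin r₂ → Set.Elem (Set.univ : Set (ComplexPoints (baseSpz ℂ (n₀ + 1) d sp))) →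
      ℂ ⊗[ℚ] singularCohomology ℚ ℚ (ComplexPoints (fiberOver (familySpz ℂ (n₀ + 1) d sp) s.1)) (n₀ + 1)),
      (∀ t ∈ W₀, ∀ (ε' : Path t₁ t), (∀ r', ε' r' ∈ W₀) →
        ∀ (T : singularCohomology ℚ ℚ (ComplexPoints (fiberOver (familySpz ℂ (n₀ + 1) d sp) s.1)) (n₀ + 1)
          ≃ₗ[ℚ] singularCohomology ℚ ℚ (ComplexPoints (fiberOver (familySpz ℂ (n₀ + 1) d sp) t.1)) (n₀ + 1)),
        (∀ v, ofRatClass _ (n₀ + 1) (T v) =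
          transportFun (familySpz ℂ (n₀ + 1) d sp) (n₀ + 1) hU ⟦ε'⟧ (ofRatClass _ (n₀ + 1) (T₁ v))) →
        LinearIndependent ℂ (fun i ↦ w₂ i t) ∧
          (((A t.1).hodgeStructure (hf.isSmoothProjective t.1) (hA t.1) (n₀ + 1)).comapEquiv T).F (n₀ + 1) =
            Submodule.span ℂ (Set.range fun i ↦ w₂ i t)) ∧
      (∀ (i : Fin r₂) (φ : Module.Dual ℂ (ℂ ⊗[ℚ] singularCohomology ℚ ℚ
          (ComplexPoints (fiberOver (familySpz ℂ (n₀ + 1) d sp) s.1)) (n₀ + 1))),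
        AnalyticOnNhd ℂ (fun z ↦ φ (w₂ i (ψ.symm z))) (ψ '' W₀)) := by
  haveI : IsSeparated (baseSpz ℂ (n₀ + 1) d sp).hom := isSeparated_baseSpz_hom ℂ (n₀ + 1) d sp
  haveI : SecondCountableTopology (ComplexPoints (totalSpz ℂ (n₀ + 1) d sp)) :=
    secondCountableTopology_complexPoints_totalSpz n₀ d sp hf
  obtain ⟨r, Ξ, W, hWo, ht₁W, -, hΞs, hdΞ, hframe⟩ := exists_residueFrame_familySpz n₀ d sp (m := m) hf hd t₁.1
  obtain ⟨W₀, hW₀o, ht₁W₀, hW₀N, hW₀pc, ψ, ⟨hψa, hψs, hψy⟩, hW₀ψ, r₂, w₂, hw₂, hhol⟩ :=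
    exists_weightFrames_of_relativeForms_chartAt (familySpz ℂ (n₀ + 1) d sp) (m := m) (Nat.le_add_left 1 n₀)
      hf hU A hA s t₁ N hN T₁ hWo ht₁W Ξ hΞs hdΞ fun t ht ↦ by
        obtain ⟨x, β, hβ, hx, hli, hspan⟩ := hframe t ht
        exact ⟨x, β, hβ, hx, hli, hspan (A t) (hA t)⟩
  refine ⟨W₀, hW₀o, ht₁W₀, hW₀N, hW₀pc, ψ, ⟨fun t ↦ ?_, fun t ↦ ?_, fun z ↦ ?_⟩, hW₀ψ, r₂, w₂, hw₂, hhol⟩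
  · rw [hψa t]
    rfl
  · rw [hψs t, extChartAt_source]
    rfl
  · rw [hψy z]
    rfl

end FF4

end Literature.AlgebraicGeometry.HodgeTheory

end
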